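import Literature.NumberTheory.LFunctions.HeilbronnPhenomenonElementary
import Literature.NumberTheory.LFunctions.HeilbronnPhenomenonElementaryProofs
import Literature.NumberTheory.LFunctions.RealZerosPintzTatuzawa
import Mathlib.NumberTheory.LSeries.Nonvanishing
import Mathlib.Analysis.SpecialFunctions.Pow.Asymptotics
import HarnessLib

/-!
# Pintz 1976 (IV), Theorems 3, 4 and 5 — the printed deductions from Theorem 2, PROVED
# (at most one real primitive character vanishes near `1`; Tatuzawa's theorems re-derived)

Topic `Literature/NumberTheory/LFunctions` (namespace `Literature.NumberTheory.LFunctions`, helpers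
in the grouping sub-namespace `Pintz1976Heilbronn`). PROOF LAYER, second file, for the statement file
`HeilbronnPhenomenonElementary.lean` (cell `parity-realchar`, SIEGEL INSTRUMENT conditionals column
I.8 / I.1), after `HeilbronnPhenomenonElementaryProofs.lean` (Theorems 1 and 2, imported). Source:
J. Pintz, *Elementary methods in the theory of L-functions, IV. The Heilbronn phenomenon*, Acta
Arith. **31** (1976) 419–429 [Pintz1976ElementaryIV], §4 pp. 426–428, READ from the journal scan
(rendered pp. 426–428). No new definitions, no named facts; standard axioms.

## What is proved

* `Pintz1976Heilbronn.productNonprincipal_of_not_same` — two primitive characters, the second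
  real, that are not "the same" (equal moduli and equal values) have a non-principal product
  `χ₁χ₂` mod `D₁D₂` (Mathlib `conductor_changeLevel`, `changeLevel_injective`): the tacit step
  "`χ_D ≠ χ_k`" ⇒ "`χ_kχ_D` non-principal" of p. 427.
* `Pintz1976Heilbronn.theorem3_of_theorem2 : pintz1976Heilbronn_theorem2 → pintz1976Heilbronn_theorem3`
  — p. 427 (4.2) verbatim: the character with the smaller modulus `k ≤ D` supplies the auxiliary
  zero `1 − γ`, `γ ≤ ε < 0.05`, `U = k(1 − γ)D ≤ D²`, so Theorem 2 gives
  `δ > 1/(140 U^{6γ} log⁵U) ≥ 1/(140·32 log⁵D·D^{12ε})`, contradicting a zero of `L(s, χ_D)` in the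
  window (2.5).
* `Pintz1976Heilbronn.theorem4_of_theorem3 : pintz1976Heilbronn_theorem3 → pintz1976Heilbronn_theorem4`
  — p. 427 (4.3): Theorem 3 with `ε/20` (after capping `ε` at `1/2`, which only weakens the claim,
  so that `ε/20 < 0.05`), the thresholds `min(ε/20, 1/(140·32 log⁵D·D^{12ε/20})) > 5/D^ε`,
  `5/D^ε ≤ 1/log D` for `D > D₀(ε)` (`theorem4_thresholds`, from `log x = o(x^r)`), and HECKE'S
  THEOREM — here the tree's PROVED part-VIII Theorem 2 `pintz1977RealZeros_theorem2_holds`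
  (`L(1, χ) > (1 − η)e^{−3/2}a` if `L(s, χ) ≠ 0` on `[1 − a, 1]`, `a ≤ 1/log D`; Pintz cites part I
  [26] with `0.23a`; both exceed the `a/5` used: `one_le_hecke_const`).
* `Pintz1976Heilbronn.theorem5a_of_theorem4 : pintz1976Heilbronn_theorem4 → pintz1976Heilbronn_theorem5a`
  — p. 427: "(2.7) is apart from a factor `π` equivalent with (2.8) (which we can naturally
  eliminate using (2.7) with `ε/2` instead of `ε`)", through Dirichlet's class number formula
  `h(−D) = √D·L(1, χ_D)/π` (`D > 4`) for the Kronecker character of an imaginary quadratic field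
  (tree: `Quadratic.exists_primitive_kroneckerChar`, `Quadratic.LFunction_one_eq_of_discr_neg_of_eq`,
  `Quadratic.torsionOrder_eq_two_of_discr_lt_neg_four`); fields with different discriminants give
  characters of different moduli, hence not "the same".
* `pintz1976Heilbronn_theorem5b_holds : pintz1976Heilbronn_theorem5b` — DISCHARGED. Road: NOT the
  printed (4.4)–(4.9) (Hecke + Landau + Theorem 1 + class number formula) but the tree's PROVED
  sharper version of the same statement in part VIII of the series, Theorem 7 (2.4)
  (`pintz1977RealZeros_theorem7b_holds`: `D ≥ (2000 h (log h + 10))²`, `D > D₀` absolute), with the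
  bookkeeping `log h + 10 ≤ 10 log(3h)`, `C = 4·10⁸ + D₀ + 1`.

* `pintz1976Heilbronn_theorem3_holds`, `pintz1976Heilbronn_theorem4_holds`,
  `pintz1976Heilbronn_theorem5a_holds` — DISCHARGED: the compositions of the theorems above with
  `pintz1976Heilbronn_theorem2_holds` (`HeilbronnPhenomenonElementaryProofs.lean`). With them every
  named fact of the statement file `HeilbronnPhenomenonElementary.lean` is a theorem.

## References

* [Pintz1976ElementaryIV] J. Pintz, *Elementary methods in the theory of L-functions, IV. The
  Heilbronn phenomenon*, Acta Arith. 31 (1976) 419–429: Theorems 3–5 p. 423–424 (2.5)–(2.9); proofs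
  §4 pp. 426–428 (4.2)–(4.9).
* [Pintz1977ElementaryVIII] J. Pintz, *Elementary methods in the theory of L-functions, VIII. Real
  zeros of real L-functions*, Acta Arith. 33 (1977) 89–98: Theorem 2 (Hecke) p. 89, Theorem 7 (2.4)
  p. 91 (tree: `RealZerosRealLFunctionsElementary*.lean`, `RealZerosPintzTatuzawa.lean`, PROVED).
* [MontgomeryVaughan2007] H. L. Montgomery, R. C. Vaughan, *Multiplicative Number Theory I*, CUP 2007,
  §9.1 (primitive characters, conductors), §10.1 Exercise 26 (Kronecker symbol of a quadratic field).
-/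

noncomputable section

open Complex

namespace Literature.NumberTheory.LFunctions

open BellottiPuglisi2023 (ProductNonprincipal)

namespace Pintz1976Heilbronn

/-- **Distinct real primitive characters have a non-principal product.** If `χ₁` mod `D₁` and `χ₂`
mod `D₂` are primitive, `χ₂` is real, and they are not "the same" (equal moduli and equal values),
then `χ₁χ₂` (both lifted to level `D₁D₂`) is not principal: were it principal, the two lifts would
agree (`χ₂⁻¹ = χ₂`), so the conductors agree (Mathlib `conductor_changeLevel`), `D₁ = D₂`, and
`changeLevel` is injective. This is the tacit step "(χ_D ≠ χ_k)" ⇒ "χ_kχ_D non-principal" of the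
printed deduction of Theorem 3 from Theorem 2. [cite: Pintz1976ElementaryIV, §4 p. 427 (4.2)] -/
theorem productNonprincipal_of_not_same {D₁ D₂ : ℕ} [NeZero D₁] [NeZero D₂]
    {χ₁ : DirichletCharacter ℂ D₁} {χ₂ : DirichletCharacter ℂ D₂}
    (h₁ : χ₁.IsPrimitive) (h₂ : χ₂.IsPrimitive) (h₂q : χ₂.IsQuadratic)
    (hne : ¬ (D₁ = D₂ ∧ ∀ n : ℕ, χ₁ (n : ZMod D₁) = χ₂ (n : ZMod D₂))) :
    ProductNonprincipal χ₁ χ₂ := by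
  intro heq
  haveI : NeZero (D₁ * D₂) := ⟨mul_ne_zero (NeZero.ne D₁) (NeZero.ne D₂)⟩
  have h1 : DirichletCharacter.changeLevel (dvd_mul_right D₁ D₂) χ₁ =
      (DirichletCharacter.changeLevel (dvd_mul_left D₂ D₁) χ₂)⁻¹ :=
    eq_inv_of_mul_eq_one_left heq
  rw [← map_inv, h₂q.inv] at h1
  have hD : D₁ = D₂ := by
    have hc := congrArg DirichletCharacter.conductor h1
    rwa [DirichletCharacter.conductor_changeLevel, DirichletCharacter.conductor_changeLevel,
      (DirichletCharacter.isPrimitive_def _).mp h₁, (DirichletCharacter.isPrimitive_def _).mp h₂]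
      at hc
  subst hD
  have h2 : χ₁ = χ₂ := DirichletCharacter.changeLevel_injective _ h1
  exact hne ⟨rfl, fun n => by rw [h2]⟩

/-- The one-sided core of "Theorem 2 ⇒ Theorem 3": with `k ≤ D`, a real zero `σ₁ ≥ 1 − ε` of
`L(s, χ_k)` (so `γ = 1 − σ₁ ≤ ε < 0.05`, `U = kσ₁D ≤ D²`, `U^{6γ} ≤ D^{12ε}`, `log⁵U ≤ 32 log⁵D`)
and Theorem 2 forbid a real zero `σ₂ ≥ 1 − 1/(140·32 log⁵D·D^{12ε})` of `L(s, χ_D)` when `χ_kχ_D`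
is non-principal. [cite: Pintz1976ElementaryIV, §4 p. 427 (4.2)] -/
theorem theorem3_oneway {D₀ : ℕ}
    (hD₀ : ∀ (k : ℕ) [NeZero k] (χk : DirichletCharacter ℂ k), χk ≠ 1 →
      ∀ γ t : ℝ, γ < 0.05 → χk.LFunction (1 - γ + t * Complex.I) = 0 →
        ∀ (D : ℕ) [NeZero D] (χD : DirichletCharacter ℂ D), D₀ < D → χD ≠ 1 → χD.IsQuadratic →
          ProductNonprincipal χk χD →
            ∀ δ : ℝ, 0 < δ → χD.LFunction ((1 - δ : ℝ) : ℂ) = 0 →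
              1 / (140 * (((k : ℝ) * ‖(1 - γ + t * Complex.I : ℂ)‖ * D) ^ (6 * γ)) *
                  Real.log ((k : ℝ) * ‖(1 - γ + t * Complex.I : ℂ)‖ * D) ^ 5) < δ)
    {ε : ℝ} (hε5 : ε < 0.05) {k : ℕ} [NeZero k] {χk : DirichletCharacter ℂ k}
    (hχk : χk ≠ 1) {σ₁ : ℝ} (hσ₁ : 1 - ε ≤ σ₁) (hσ₁1 : σ₁ ≤ 1) (hz₁ : χk.LFunction σ₁ = 0)
    {D : ℕ} [NeZero D] {χD : DirichletCharacter ℂ D} (hD : D₀ < D) (hD2 : 2 ≤ D) (hkD : k ≤ D)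
    (hχD : χD ≠ 1) (hquad : χD.IsQuadratic) (hprod : ProductNonprincipal χk χD) {σ₂ : ℝ}
    (hσ₂ : 1 - 1 / (140 * 32 * Real.log D ^ 5 * (D : ℝ) ^ (12 * ε)) ≤ σ₂)
    (hz₂ : χD.LFunction σ₂ = 0) : False := by
  -- both zeros are `< 1`
  have hσ₁lt : σ₁ < 1 := by
    by_contra hle
    push Not at hle
    exact DirichletCharacter.LFunction_ne_zero_of_one_le_re χk (Or.inl hχk) (s := σ₁)
      (by simpa using hle) hz₁
  have hσ₂lt : σ₂ < 1 := by
    by_contra hle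
    push Not at hle
    exact DirichletCharacter.LFunction_ne_zero_of_one_le_re χD (Or.inl hχD) (s := σ₂)
      (by simpa using hle) hz₂
  set γ : ℝ := 1 - σ₁ with hγdef
  have hγ0 : 0 < γ := by simp only [hγdef]; linarith
  have hγε : γ ≤ ε := by simp only [hγdef]; linarith
  have hγ5 : γ < 0.05 := lt_of_le_of_lt hγε hε5
  have hσ₁pos : 0 < σ₁ := by linarith
  have hs : (1 - γ + (0 : ℝ) * Complex.I : ℂ) = (σ₁ : ℂ) := by
    simp only [hγdef]; push_cast; ring
  have hz' : χk.LFunction (1 - γ + (0 : ℝ) * Complex.I) = 0 := by rw [hs]; exact hz₁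
  have hδ : χD.LFunction ((1 - (1 - σ₂) : ℝ) : ℂ) = 0 := by
    rw [show (1 : ℝ) - (1 - σ₂) = σ₂ by ring]; exact hz₂
  have key := hD₀ k χk hχk γ 0 hγ5 hz' D χD hD hχD hquad hprod (1 - σ₂) (by linarith) hδ
  rw [hs, Complex.norm_real, Real.norm_eq_abs, abs_of_pos hσ₁pos] at key
  -- `U = k σ₁ D`, `1 < U ≤ D²`
  set U : ℝ := (k : ℝ) * σ₁ * D with hUdef
  have hk1 : (1 : ℝ) ≤ k := by exact_mod_cast Nat.one_le_iff_ne_zero.mpr (NeZero.ne k)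
  have hD2r : (2 : ℝ) ≤ D := by exact_mod_cast hD2
  have hkDr : (k : ℝ) ≤ D := by exact_mod_cast hkD
  have hD0 : (0 : ℝ) < D := by linarith
  have hU1 : 1 < U := by
    have h1 : 0.95 * 2 ≤ σ₁ * D := by nlinarith
    have h2 : σ₁ * D ≤ U := by
      simp only [hUdef]
      have : (1 : ℝ) * (σ₁ * D) ≤ k * (σ₁ * D) := by gcongr
      linarith
    linarith
  have hU0 : 0 < U := by linarith
  have hUD : U ≤ (D : ℝ) ^ 2 := by
    simp only [hUdef]
    calc (k : ℝ) * σ₁ * D ≤ D * 1 * D := by gcongr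
      _ = (D : ℝ) ^ 2 := by ring
  -- `log U ≤ 2 log D`, `log⁵U ≤ 32 log⁵D`
  have hLU0 : 0 < Real.log U := Real.log_pos hU1
  have hLUD : Real.log U ≤ 2 * Real.log D := by
    have := Real.log_le_log hU0 hUD
    rwa [Real.log_pow, Nat.cast_ofNat] at this
  have hL5 : Real.log U ^ 5 ≤ 32 * Real.log D ^ 5 := by
    calc Real.log U ^ 5 ≤ (2 * Real.log D) ^ 5 := by gcongr
      _ = 32 * Real.log D ^ 5 := by ring
  -- `U^{6γ} ≤ D^{12γ} ≤ D^{12ε}`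
  have hP : U ^ (6 * γ) ≤ (D : ℝ) ^ (12 * ε) := by
    calc U ^ (6 * γ) ≤ ((D : ℝ) ^ 2) ^ (6 * γ) := Real.rpow_le_rpow hU0.le hUD (by linarith)
      _ = (D : ℝ) ^ (12 * γ) := by
        rw [show ((D : ℝ) ^ 2) = (D : ℝ) ^ (2 : ℝ) by norm_cast, ← Real.rpow_mul hD0.le]
        ring_nf
      _ ≤ (D : ℝ) ^ (12 * ε) := Real.rpow_le_rpow_of_exponent_le (by linarith) (by linarith)
  have hP0 : 0 < U ^ (6 * γ) := Real.rpow_pos_of_pos hU0 _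
  -- compare the two windows
  set W : ℝ := 140 * 32 * Real.log D ^ 5 * (D : ℝ) ^ (12 * ε) with hWdef
  have hAW : 140 * U ^ (6 * γ) * Real.log U ^ 5 ≤ W := by
    calc 140 * U ^ (6 * γ) * Real.log U ^ 5 ≤ 140 * (D : ℝ) ^ (12 * ε) * (32 * Real.log D ^ 5) := by
          gcongr
      _ = W := by simp only [hWdef]; ring
  have hA0 : 0 < 140 * U ^ (6 * γ) * Real.log U ^ 5 := by positivity
  have h1 : 1 / W ≤ 1 / (140 * U ^ (6 * γ) * Real.log U ^ 5) :=
    div_le_div_of_nonneg_left (by norm_num) hA0 hAW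
  have h2 : 1 - σ₂ ≤ 1 / W := by linarith
  linarith

end Pintz1976Heilbronn

open Pintz1976Heilbronn in
/-- **Pintz 1976 (IV), Theorem 3 from Theorem 2 — the printed deduction (4.2), PROVED.** "Theorem 2
implies Theorem 3, so let us assume that `k` is the minimal modulus for which an `L`-function
belonging to a real primitive character mod `k` has a real zero `1 − γ` in the interval (2.5). Then
for an arbitrary modulus `D ≥ k` and for the real primitive character `χ_D mod D` (`χ_D ≠ χ_k`), for
the greatest real zero `1 − δ` of `L(s, χ_D)` holds by Theorem 2:
`δ > 1/(140 U^{6γ} log⁵U) = 1/(140[kD(1 − γ)]^{6γ} log⁵[kD(1 − γ)]) > 1/(140·32 log⁵D·D^{12γ}) ≥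
1/(140·32 log⁵D·D^{12ε})`." Pairwise: the character with the smaller modulus supplies the auxiliary
zero; `χ_D ≠ χ_k` makes `χ_kχ_D` non-principal (`productNonprincipal_of_not_same`).
[cite: Pintz1976ElementaryIV, Theorem 3 p. 423 (2.5); proof §4 p. 427 (4.2)] -/
theorem Pintz1976Heilbronn.theorem3_of_theorem2 (h : pintz1976Heilbronn_theorem2) :
    pintz1976Heilbronn_theorem3 := by
  obtain ⟨D₀, hD₀⟩ := h
  refine ⟨D₀ + 2, fun ε _hε hε5 D₁ _ χ₁ D₂ _ χ₂ hD₁ hD₂ h1q h1p h1ne h2q h2p h2ne hz1 hz2 => ?_⟩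
  obtain ⟨σ₁, hσ₁l, hσ₁u, hz₁⟩ := hz1
  obtain ⟨σ₂, hσ₂l, hσ₂u, hz₂⟩ := hz2
  by_contra hne
  have hprod : ProductNonprincipal χ₁ χ₂ := productNonprincipal_of_not_same h1p h2p h2q hne
  have hprod' : ProductNonprincipal χ₂ χ₁ :=
    productNonprincipal_of_not_same h2p h1p h1q fun hh => hne ⟨hh.1.symm, fun n => (hh.2 n).symm⟩
  have hm₁ := min_le_left ε (1 / (140 * 32 * Real.log D₁ ^ 5 * (D₁ : ℝ) ^ (12 * ε)))
  have hm₁' := min_le_right ε (1 / (140 * 32 * Real.log D₁ ^ 5 * (D₁ : ℝ) ^ (12 * ε)))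
  have hm₂ := min_le_left ε (1 / (140 * 32 * Real.log D₂ ^ 5 * (D₂ : ℝ) ^ (12 * ε)))
  have hm₂' := min_le_right ε (1 / (140 * 32 * Real.log D₂ ^ 5 * (D₂ : ℝ) ^ (12 * ε)))
  rcases le_total D₁ D₂ with hle | hle
  · exact theorem3_oneway hD₀ hε5 h1ne (by linarith) hσ₁u hz₁ (by omega) (by omega) hle h2ne h2q
      hprod (by linarith) hz₂
  · exact theorem3_oneway hD₀ hε5 h2ne (by linarith) hσ₂u hz₂ (by omega) (by omega) hle h1ne h1q
      hprod' (by linarith) hz₁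

namespace Pintz1976Heilbronn

/-! ### Theorem 4 from Theorem 3 and Hecke's theorem -/

/-- The thresholds of the deduction "Theorem 3 ⇒ Theorem 4": for `ε₁ > 0` and all large `D`,
`5 log D ≤ D^{ε₁}`, `100/ε₁ < D^{ε₁}` and `22400 log⁵D < D^{(2/5)ε₁}` (the printed "(4.3)
`min(ε/20, 1/(140·32 log⁵D·D^{12ε/20})) > 5/D^ε` for `D > D₀(ε)`", and `5/D^ε ≤ 1/log D` for Hecke's
theorem). [cite: Pintz1976ElementaryIV, §4 p. 427 (4.3)] -/
theorem theorem4_thresholds {ε₁ : ℝ} (hε₁ : 0 < ε₁) : ∃ N : ℕ, ∀ D : ℕ, N ≤ D →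
    5 * Real.log D ≤ (D : ℝ) ^ ε₁ ∧ 100 / ε₁ < (D : ℝ) ^ ε₁ ∧
      22400 * Real.log D ^ 5 < (D : ℝ) ^ (2 / 5 * ε₁) := by
  have h5 : ∀ x : ℝ, Real.log x ^ (5 : ℝ) = Real.log x ^ 5 := fun x => by
    rw [show (5 : ℝ) = ((5 : ℕ) : ℝ) by norm_num, Real.rpow_natCast]
  have e1 : ∀ᶠ x : ℝ in Filter.atTop, 5 * Real.log x ≤ x ^ ε₁ := by
    have hb := (isLittleO_log_rpow_atTop hε₁).bound (show (0 : ℝ) < 1 / 5 by norm_num)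
    filter_upwards [hb, Filter.eventually_ge_atTop 1] with x hx hx1
    rw [Real.norm_of_nonneg (Real.log_nonneg hx1),
      Real.norm_of_nonneg (Real.rpow_nonneg (by linarith) _)] at hx
    linarith
  have e2 : ∀ᶠ x : ℝ in Filter.atTop, 100 / ε₁ < x ^ ε₁ :=
    (tendsto_rpow_atTop hε₁).eventually_gt_atTop _
  have e3 : ∀ᶠ x : ℝ in Filter.atTop, 22400 * Real.log x ^ 5 < x ^ (2 / 5 * ε₁) := by
    have hb := (isLittleO_log_rpow_rpow_atTop (5 : ℝ) (show (0 : ℝ) < 2 / 5 * ε₁ by positivity)).bound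
      (show (0 : ℝ) < 1 / 22401 by norm_num)
    filter_upwards [hb, Filter.eventually_gt_atTop 1] with x hx hx1
    rw [h5, Real.norm_of_nonneg (pow_nonneg (Real.log_nonneg hx1.le) 5),
      Real.norm_of_nonneg (Real.rpow_nonneg (by linarith) _)] at hx
    have hpos : 0 < x ^ (2 / 5 * ε₁) := Real.rpow_pos_of_pos (by linarith) _
    linarith
  have hall := tendsto_natCast_atTop_atTop.eventually (e1.and (e2.and e3))
  obtain ⟨N, hN⟩ := Filter.eventually_atTop.mp hall
  exact ⟨N, fun D hD => hN D hD⟩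

/-- `(1 − 0.05)·e^{−3/2}·5 ≥ 1` (`e³ < 2.7182818286³ < 22.5625 = 4.75²`): Hecke's constant
`e^{−3/2}(1 + o(1))` of part VIII exceeds the `1/5` used on p. 427 ("`L(1, χ_D) > 0.23a > a/5`").
[cite: Pintz1976ElementaryIV, §4 p. 427] -/
theorem one_le_hecke_const : (1 : ℝ) ≤ (1 - 0.05) * Real.exp (-3 / 2) * 5 := by
  have he := Real.exp_one_lt_d9
  have he0 := Real.exp_pos (1 : ℝ)
  have h3 : Real.exp (3 / 2) ^ 2 = Real.exp 1 ^ 3 := by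
    rw [← Real.exp_one_rpow, ← Real.rpow_natCast, ← Real.rpow_mul he0.le, Real.exp_one_rpow,
      ← Real.rpow_natCast, Real.exp_one_rpow]
    norm_num
  have hpos : 0 < Real.exp (3 / 2 : ℝ) := Real.exp_pos _
  have hcube : Real.exp 1 ^ 3 < 2.7182818286 ^ 3 := by gcongr
  have hlt : Real.exp (3 / 2 : ℝ) < 4.75 := by nlinarith
  rw [show (-3 / 2 : ℝ) = -(3 / 2) by norm_num, Real.exp_neg]
  rw [show (1 - 0.05) * (Real.exp (3 / 2))⁻¹ * 5 = 4.75 / Real.exp (3 / 2) by ring,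
    le_div_iff₀ hpos]
  linarith

/-- The per-character step of "Theorem 3 ⇒ Theorem 4": if the real non-principal `χ` mod `D` has NO
real zero in Theorem 3's window `[1 − min(ε′, 1/(140·32 log⁵D·D^{12ε′})), 1]`, and `D` is beyond the
thresholds (`5D^{−ε₁} <` both window widths, `5D^{−ε₁} ≤ 1/log D`, Hecke's `D₀`), then `L(s, χ) ≠ 0`
on `[1 − D^{−ε}, 1]` and, by Hecke's theorem with `a = 5D^{−ε₁}` (`ε₁ ≤ ε`), `L(1, χ) > D^{−ε}`
((2.6) "with a constant 5 instead of 1", then (2.7)). [cite: Pintz1976ElementaryIV, §4 p. 427 (4.3)] -/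
theorem theorem4_good {DH : ℕ}
    (hDH : ∀ (D : ℕ) [NeZero D], DH ≤ D → ∀ χ : DirichletCharacter ℂ D, χ.IsQuadratic → χ ≠ 1 →
      ∀ β : ℝ, 0 < β → β ≤ 1 / Real.log D →
        (∀ σ : ℝ, 1 - β ≤ σ → σ ≤ 1 → χ.LFunction (σ : ℂ) ≠ 0) →
          (1 - 0.05) * Real.exp (-3 / 2) * β < (χ.LFunction 1).re)
    {ε ε₁ ε' : ℝ} (hε₁ε : ε₁ ≤ ε) {D : ℕ} [NeZero D] {χ : DirichletCharacter ℂ D}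
    (hq : χ.IsQuadratic) (hne : χ ≠ 1) (hDH' : DH ≤ D) (hD2 : 2 ≤ D)
    (hT1 : 5 * Real.log D ≤ (D : ℝ) ^ ε₁) (hT2 : 5 * (D : ℝ) ^ (-ε₁) < ε')
    (hT3 : 5 * (D : ℝ) ^ (-ε₁) < 1 / (140 * 32 * Real.log D ^ 5 * (D : ℝ) ^ (12 * ε')))
    (hW : ¬ ∃ σ : ℝ, 1 - min ε' (1 / (140 * 32 * Real.log D ^ 5 * (D : ℝ) ^ (12 * ε'))) ≤ σ ∧
      σ ≤ 1 ∧ χ.LFunction (σ : ℂ) = 0) :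
    (∀ σ : ℝ, 1 - (D : ℝ) ^ (-ε) ≤ σ → σ ≤ 1 → χ.LFunction (σ : ℂ) ≠ 0) ∧
      (D : ℝ) ^ (-ε) < (χ.LFunction 1).re := by
  have hD0 : (0 : ℝ) < D := by exact_mod_cast (show 0 < D by omega)
  have hD1 : (1 : ℝ) ≤ D := by exact_mod_cast (show 1 ≤ D by omega)
  have hLD : 0 < Real.log D := Real.log_pos (by exact_mod_cast (show 1 < D by omega))
  set β : ℝ := 5 * (D : ℝ) ^ (-ε₁) with hβ
  have hrpos : 0 < (D : ℝ) ^ (-ε₁) := Real.rpow_pos_of_pos hD0 _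
  have hβ0 : 0 < β := by positivity
  have hZF : ∀ σ : ℝ, 1 - β ≤ σ → σ ≤ 1 → χ.LFunction (σ : ℂ) ≠ 0 := by
    intro σ h1 h2 hz
    refine hW ⟨σ, ?_, h2, hz⟩
    have : β ≤ min ε' (1 / (140 * 32 * Real.log D ^ 5 * (D : ℝ) ^ (12 * ε'))) :=
      le_min hT2.le hT3.le
    linarith
  have hεε₁ : (D : ℝ) ^ (-ε) ≤ (D : ℝ) ^ (-ε₁) :=
    Real.rpow_le_rpow_of_exponent_le hD1 (by linarith)
  refine ⟨fun σ h1 h2 => hZF σ (by linarith) h2, ?_⟩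
  have hβ1 : β ≤ 1 / Real.log D := by
    have e : (D : ℝ) ^ (-ε₁) = 1 / (D : ℝ) ^ ε₁ := by rw [Real.rpow_neg hD0.le, one_div]
    rw [hβ, e, show (5 : ℝ) * (1 / (D : ℝ) ^ ε₁) = 5 / (D : ℝ) ^ ε₁ by ring,
      div_le_div_iff₀ (Real.rpow_pos_of_pos hD0 _) hLD]
    linarith
  have hH := hDH D hDH' χ hq hne β hβ0 hβ1 hZF
  have hc := mul_le_mul_of_nonneg_left one_le_hecke_const hβ0.le
  have h5 : (D : ℝ) ^ (-ε₁) = β / 5 := by simp only [hβ]; ring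
  rw [h5] at hεε₁
  linarith

/-- `κ² = 1` ⇒ `κ` is quadratic (values in `{0, ±1}`). [folklore] -/
private theorem isQuadratic_of_sq_eq_one {M : ℕ} {κ : DirichletCharacter ℂ M} (hsq : κ ^ 2 = 1) :
    κ.IsQuadratic := by
  intro a
  by_cases ha : IsUnit a
  · have h2' : κ a ^ 2 = 1 := by
      have := congrArg (fun ψ : DirichletCharacter ℂ M ↦ ψ a) hsq
      simpa [MulChar.pow_apply' κ two_ne_zero, MulChar.one_apply ha] using this
    exact Or.inr (sq_eq_one_iff.mp h2')
  · exact Or.inl (κ.map_nonunit ha)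

end Pintz1976Heilbronn

open Pintz1976Heilbronn in
/-- **Pintz 1976 (IV), Theorem 4 from Theorem 3 — the printed deduction (4.3), PROVED** (Tatuzawa's
theorem re-derived). p. 427: "Applying Theorem 3 with `ε/20` instead of `ε`, and considering that for
a `D > D₀(ε)` (effective constant) `min(ε/20, 1/(140·32 log⁵D·D^{12ε/20})) > 5/D^ε` we get (2.6) with
a constant 5 instead of 1. But we proved in [26] (Hecke's theorem), if a real `L`-function has no zero
in the interval `[1 − a, 1]` for `a ≤ 1/(20 log D)` then `L(1, χ_D) > 0.23a > a/5` and so (2.6) (in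
this modified form) implies (2.7)." Here Hecke's theorem is the tree's PROVED part-VIII Theorem 2
(`pintz1977RealZeros_theorem2_holds`, constant `(1 + o(1))e^{−3/2} > 1/5`, `a ≤ 1/log D`), and
`ε` is first capped at `1/2` (the statement for `ε` follows from the one for `min(ε, 1/2)`), so that
`ε/20 < 0.05` as Theorem 3 requires. Of two distinct real primitive characters beyond `D₀(ε)`,
Theorem 3 leaves at most one with a zero in its window; the other is zero-free there and Hecke's
theorem applies to it. [cite: Pintz1976ElementaryIV, Theorem 4 p. 423 (2.6)–(2.7); proof §4 p. 427 (4.3)] -/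
theorem Pintz1976Heilbronn.theorem4_of_theorem3 (h3 : pintz1976Heilbronn_theorem3) :
    pintz1976Heilbronn_theorem4 := by
  intro ε hε
  set ε₁ : ℝ := min ε (1 / 2) with hε₁
  have hε₁0 : 0 < ε₁ := lt_min hε (by norm_num)
  have hε₁ε : ε₁ ≤ ε := min_le_left _ _
  have hε₁h : ε₁ ≤ 1 / 2 := min_le_right _ _
  set ε' : ℝ := ε₁ / 20 with hε'
  have hε'0 : 0 < ε' := by positivity
  have hε'5 : ε' < 0.05 := by simp only [hε']; linarith
  obtain ⟨D₃, hD₃⟩ := h3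
  obtain ⟨DH, hDH⟩ := pintz1977RealZeros_theorem2_holds 0.05 (by norm_num)
  obtain ⟨N, hN⟩ := theorem4_thresholds hε₁0
  refine ⟨N + DH + D₃ + 2, ?_⟩
  intro D₁ _ χ₁ D₂ _ χ₂ hD₁ hD₂ h1q h1p h1ne h2q h2p h2ne hne
  have win : ∀ D : ℕ, N + DH + D₃ + 2 < D →
      5 * Real.log D ≤ (D : ℝ) ^ ε₁ ∧ 5 * (D : ℝ) ^ (-ε₁) < ε' ∧
        5 * (D : ℝ) ^ (-ε₁) < 1 / (140 * 32 * Real.log D ^ 5 * (D : ℝ) ^ (12 * ε')) := by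
    intro D hD
    obtain ⟨t1, t2, t3⟩ := hN D (by omega)
    have hD0 : (0 : ℝ) < D := by exact_mod_cast (show 0 < D by omega)
    have hLD : 0 < Real.log D := Real.log_pos (by exact_mod_cast (show 1 < D by omega))
    have hr0 : 0 < (D : ℝ) ^ ε₁ := Real.rpow_pos_of_pos hD0 _
    have e : (D : ℝ) ^ (-ε₁) = 1 / (D : ℝ) ^ ε₁ := by rw [Real.rpow_neg hD0.le, one_div]
    refine ⟨t1, ?_, ?_⟩
    · rw [e, show (5 : ℝ) * (1 / (D : ℝ) ^ ε₁) = 5 / (D : ℝ) ^ ε₁ by ring, div_lt_iff₀ hr0]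
      have := (div_lt_iff₀ hε₁0).mp t2
      simp only [hε']
      nlinarith
    · have h12 : 12 * ε' = 3 / 5 * ε₁ := by simp only [hε']; ring
      have hsplit : (D : ℝ) ^ ε₁ = (D : ℝ) ^ (2 / 5 * ε₁) * (D : ℝ) ^ (3 / 5 * ε₁) := by
        rw [← Real.rpow_add hD0]; congr 1; ring
      have hB0 : 0 < 140 * 32 * Real.log D ^ 5 * (D : ℝ) ^ (12 * ε') := by positivity
      rw [e, show (5 : ℝ) * (1 / (D : ℝ) ^ ε₁) = 5 / (D : ℝ) ^ ε₁ by ring,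
        div_lt_div_iff₀ hr0 hB0, h12, one_mul, hsplit]
      have hpos : 0 < (D : ℝ) ^ (3 / 5 * ε₁) := Real.rpow_pos_of_pos hD0 _
      nlinarith [mul_lt_mul_of_pos_right t3 hpos]
  obtain ⟨a1, a2, a3⟩ := win D₁ hD₁
  obtain ⟨b1, b2, b3⟩ := win D₂ hD₂
  have h3' := hD₃ ε' hε'0 hε'5 D₁ χ₁ D₂ χ₂ (by omega) (by omega) h1q h1p h1ne h2q h2p h2ne
  by_cases hW₁ : ∃ σ₁ : ℝ, 1 - min ε' (1 / (140 * 32 * Real.log D₁ ^ 5 * (D₁ : ℝ) ^ (12 * ε'))) ≤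
      σ₁ ∧ σ₁ ≤ 1 ∧ χ₁.LFunction (σ₁ : ℂ) = 0
  · have hW₂ : ¬ ∃ σ₂ : ℝ, 1 - min ε' (1 / (140 * 32 * Real.log D₂ ^ 5 * (D₂ : ℝ) ^ (12 * ε'))) ≤
        σ₂ ∧ σ₂ ≤ 1 ∧ χ₂.LFunction (σ₂ : ℂ) = 0 := fun hW₂ => hne (h3' hW₁ hW₂)
    exact Or.inr (theorem4_good hDH hε₁ε h2q h2ne (by omega) (by omega) b1 b2 b3 hW₂)
  · exact Or.inl (theorem4_good hDH hε₁ε h1q h1ne (by omega) (by omega) a1 a2 a3 hW₁)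

namespace Pintz1976Heilbronn

/-! ### Theorem 5 (first part) from Theorem 4 and Dirichlet's class number formula -/

/-- The class-number-formula step of "Theorem 4 ⇒ Theorem 5": for an imaginary quadratic field `K`
with `|d_K| = M > 4` and Kronecker character `κ` mod `M` (`ζ_K = ζ·L(·, κ)`), the bound
`L(1, κ) > M^{−ε/2}` gives `h_K = √M·L(1, κ)/π > M^{1/2 − ε/2}/π ≥ M^{1/2 − ε}` once `M^{ε/2} ≥ π`
(p. 427: "(2.7) is apart from a factor `π` equivalent with (2.8) (which we can naturally eliminate
using (2.7) with `ε/2` instead of `ε`)"). [cite: Pintz1976ElementaryIV, §4 p. 427] -/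
theorem classNumber_gt_of_lOne_gt {K : Type} [Field K] [NumberField K]
    (h2 : Module.finrank ℚ K = 2) (hd : NumberField.discr K < 0) {M : ℕ} [NeZero M]
    {κ : DirichletCharacter ℂ M} (hM : M = (NumberField.discr K).natAbs) (hκ : κ ≠ 1)
    (hfac : ∀ s : ℂ, 1 < s.re →
      NumberField.dedekindZeta K s = riemannZeta s * LSeries (fun n ↦ κ n) s)
    (hM4 : 4 < M) {ε : ℝ} (hπ : Real.pi ≤ (M : ℝ) ^ (ε / 2))
    (hP : (M : ℝ) ^ (-(ε / 2)) < (κ.LFunction 1).re) :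
    (M : ℝ) ^ (1 / 2 - ε) < (NumberField.classNumber K : ℝ) := by
  have hMpos : (0 : ℝ) < M := by exact_mod_cast (show 0 < M by omega)
  have hd4 : NumberField.discr K < -4 := by
    have : (4 : ℤ) < ((NumberField.discr K).natAbs : ℤ) := by rw [← hM]; exact_mod_cast hM4
    omega
  have hcnf :=
    Literature.NumberTheory.QuadraticFields.Quadratic.LFunction_one_eq_of_discr_neg_of_eq h2 hd hκ
      (fun s hs ↦ hfac s (by simpa using hs))
  have hw : (NumberField.Units.torsionOrder K : ℝ) = 2 := by
    exact_mod_cast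
      Literature.NumberTheory.QuadraticFields.Quadratic.torsionOrder_eq_two_of_discr_lt_neg_four h2
        hd4
  have habs : |(NumberField.discr K : ℝ)| = (M : ℝ) := by
    rw [← Int.cast_abs, Int.abs_eq_natAbs, Int.cast_natCast, hM]
  rw [hcnf, hw, habs, Complex.ofReal_re] at hP
  have hsq0 : 0 < Real.sqrt (M : ℝ) := Real.sqrt_pos.2 hMpos
  have h1 : (M : ℝ) ^ (-(ε / 2)) * (2 * Real.sqrt M) < 2 * Real.pi * NumberField.classNumber K :=
    (lt_div_iff₀ (by positivity)).mp hP
  have e1 : (M : ℝ) ^ (-(ε / 2)) * Real.sqrt M = (M : ℝ) ^ (1 / 2 - ε / 2) := by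
    rw [Real.sqrt_eq_rpow, ← Real.rpow_add hMpos]; congr 1; ring
  have e2 : (M : ℝ) ^ (1 / 2 - ε) * (M : ℝ) ^ (ε / 2) = (M : ℝ) ^ (1 / 2 - ε / 2) := by
    rw [← Real.rpow_add hMpos]; congr 1; ring
  have h0 : 0 ≤ (M : ℝ) ^ (1 / 2 - ε) := Real.rpow_nonneg hMpos.le _
  have h3 : Real.pi * (M : ℝ) ^ (1 / 2 - ε) ≤ (M : ℝ) ^ (1 / 2 - ε / 2) := by
    rw [← e2]; nlinarith [mul_le_mul_of_nonneg_left hπ h0]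
  have h4 : Real.pi * (M : ℝ) ^ (1 / 2 - ε) < Real.pi * NumberField.classNumber K := by
    nlinarith
  exact lt_of_mul_lt_mul_left h4 Real.pi_pos.le

end Pintz1976Heilbronn

open Pintz1976Heilbronn in
/-- **Pintz 1976 (IV), Theorem 5 (2.8) from Theorem 4 — the printed deduction, PROVED.** p. 427:
"(2.7) is apart from a factor `π` equivalent with (2.8) (which we can naturally eliminate using (2.7)
with `ε/2` instead of `ε`)": for an imaginary quadratic field with fundamental discriminant `−D`,
`h(−D) = √D·L(1, χ_D)/π` (`D > 4`, `w = 2`; the tree's `Quadratic.exists_primitive_kroneckerChar` and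
`Quadratic.LFunction_one_eq_of_discr_neg_of_eq`), where `χ_D = (−D/·)` is real, primitive and
non-principal mod `D`; fields with different discriminants have different moduli `D`, hence are not
"the same" character, and Theorem 4 (with `ε/2`) bounds `L(1, χ_D) > D^{−ε/2}` for at least one of
the two, whence `h(−D) > D^{1/2−ε/2}/π ≥ D^{1/2−ε}` for `D^{ε/2} ≥ π`.
[cite: Pintz1976ElementaryIV, Theorem 5 p. 424 (2.8); proof §4 p. 427] -/
theorem Pintz1976Heilbronn.theorem5a_of_theorem4 (h4 : pintz1976Heilbronn_theorem4) :
    pintz1976Heilbronn_theorem5a := by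
  intro ε hε
  obtain ⟨D₀, hD₀⟩ := h4 (ε / 2) (by positivity)
  obtain ⟨N, hN⟩ : ∃ N : ℕ, ∀ D : ℕ, N ≤ D → Real.pi ≤ (D : ℝ) ^ (ε / 2) := by
    have := tendsto_natCast_atTop_atTop.eventually
      ((tendsto_rpow_atTop (show 0 < ε / 2 by positivity)).eventually_ge_atTop Real.pi)
    obtain ⟨N, hN⟩ := Filter.eventually_atTop.mp this
    exact ⟨N, fun D hD => hN D hD⟩
  refine ⟨D₀ + N + 5, fun K₁ _ _ K₂ _ _ h2₁ h2₂ hd₁ hd₂ hD₁ hD₂ hne => ?_⟩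
  obtain ⟨M₁, _, κ₁, hM₁, hκ₁, hsq₁, hprim₁, hfac₁⟩ :=
    Literature.NumberTheory.QuadraticFields.Quadratic.exists_primitive_kroneckerChar h2₁
  obtain ⟨M₂, _, κ₂, hM₂, hκ₂, hsq₂, hprim₂, hfac₂⟩ :=
    Literature.NumberTheory.QuadraticFields.Quadratic.exists_primitive_kroneckerChar h2₂
  have hq₁ := isQuadratic_of_sq_eq_one hsq₁
  have hq₂ := isQuadratic_of_sq_eq_one hsq₂
  have hM₁' : D₀ + N + 5 ≤ M₁ := by rw [hM₁]; exact hD₁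
  have hM₂' : D₀ + N + 5 ≤ M₂ := by rw [hM₂]; exact hD₂
  have hnot : ¬ (M₁ = M₂ ∧ ∀ n : ℕ, κ₁ (n : ZMod M₁) = κ₂ (n : ZMod M₂)) := by
    rintro ⟨hMM, -⟩
    apply hne
    have e1 : NumberField.discr K₁ = -((NumberField.discr K₁).natAbs : ℤ) := by omega
    have e2 : NumberField.discr K₂ = -((NumberField.discr K₂).natAbs : ℤ) := by omega
    rw [e1, e2, ← hM₁, ← hM₂, hMM]
  rcases hD₀ M₁ κ₁ M₂ κ₂ (by omega) (by omega) hq₁ hprim₁ hκ₁ hq₂ hprim₂ hκ₂ hnot with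
    ⟨-, hP⟩ | ⟨-, hP⟩
  · left
    rw [← hM₁]
    exact classNumber_gt_of_lOne_gt h2₁ hd₁ hM₁ hκ₁ hfac₁ (by omega) (hN M₁ (by omega)) hP
  · right
    rw [← hM₂]
    exact classNumber_gt_of_lOne_gt h2₂ hd₂ hM₂ hκ₂ hfac₂ (by omega) (hN M₂ (by omega)) hP

/-! ### Theorem 5 (second part) -/

/-- **Pintz 1976 (IV), Theorem 5 (2.9) — PROVED** ("if `−D` is a negative fundamental discriminant,
`h` an arbitrary natural number, `D > Ch² log²(3h)` (`C` is an absolute effective constant), then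
`h(−D) > h`, with the possible exception of at most one negative fundamental discriminant"; pairwise
over imaginary quadratic fields). ROAD: not the printed (4.4)–(4.9) (Hecke + Landau + Theorem 1), but
the tree's PROVED sharper form of the same theorem from part VIII of the series — Theorem 7 (2.4),
`pintz1977RealZeros_theorem7b_holds` ("`h ≥ 1`, `D ≥ (2000 h (log h + 10))²`, `D > D₀` absolute ⇒
`h(−D) > h` with at most one exception", pairwise reading `Pintz1977RealZeros.classNumber_gt_of_theorem7b`)
— with the bookkeeping `log h + 10 ≤ 10 log(3h)` (`log 3 > 1`), so that
`C = 4·10⁸ + D₀ + 1` gives `C h² log²(3h) ≥ max((2000 h (log h + 10))², D₀ + 1)`.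
[cite: Pintz1976ElementaryIV, Theorem 5 p. 424 (2.9)]
[cite: Pintz1977ElementaryVIII, Theorem 7 (2.4) p. 91] -/
theorem pintz1976Heilbronn_theorem5b_holds : pintz1976Heilbronn_theorem5b := by
  obtain ⟨D₀, hD₀⟩ :=
    Pintz1977RealZeros.classNumber_gt_of_theorem7b pintz1977RealZeros_theorem7b_holds
  refine ⟨4 * 10 ^ 8 + ((D₀ : ℝ) + 1), fun h hh K₁ _ _ K₂ _ _ h2₁ h2₂ hd₁ hd₂ hC₁ hC₂ hne => ?_⟩
  have hh1 : (1 : ℝ) ≤ h := by exact_mod_cast hh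
  have hlog3 : 1 < Real.log 3 := by
    rw [Real.lt_log_iff_exp_lt (by norm_num)]
    have := Real.exp_one_lt_d9
    linarith
  have hlogh : 0 ≤ Real.log h := Real.log_nonneg hh1
  have hL : Real.log (3 * h) = Real.log 3 + Real.log h :=
    Real.log_mul (by norm_num) (by positivity)
  have hL1 : 1 ≤ Real.log (3 * h) := by rw [hL]; linarith
  have hbase : ∀ X : ℝ, (4 * 10 ^ 8 + ((D₀ : ℝ) + 1)) * (h : ℝ) ^ 2 * Real.log (3 * h) ^ 2 < X →
      (D₀ : ℝ) < X ∧ (2000 * (h : ℝ) * (Real.log h + 10)) ^ 2 ≤ X := by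
    intro X hX
    have hsq : 1 ≤ (h : ℝ) ^ 2 * Real.log (3 * h) ^ 2 := by
      have h1 : 1 ≤ (h : ℝ) ^ 2 := by nlinarith
      have h2 : 1 ≤ Real.log (3 * h) ^ 2 := by nlinarith
      nlinarith
    have h10 : Real.log h + 10 ≤ 10 * Real.log (3 * h) := by rw [hL]; nlinarith
    have h0 : 0 ≤ 2000 * (h : ℝ) * (Real.log h + 10) := by positivity
    have hsq' : (2000 * (h : ℝ) * (Real.log h + 10)) ^ 2 ≤
        (2000 * (h : ℝ) * (10 * Real.log (3 * h))) ^ 2 := by gcongr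
    have hD0 : (0 : ℝ) ≤ D₀ := Nat.cast_nonneg _
    constructor
    · nlinarith
    · nlinarith
  obtain ⟨a1, a2⟩ := hbase _ hC₁
  obtain ⟨b1, b2⟩ := hbase _ hC₂
  have hD₁ : D₀ < (NumberField.discr K₁).natAbs := by exact_mod_cast a1
  have hD₂ : D₀ < (NumberField.discr K₂).natAbs := by exact_mod_cast b1
  exact hD₀ h hh K₁ K₂ h2₁ hd₁ h2₂ hd₂ hne hD₁ hD₂ a2 b2

/-! ### The discharges of Theorems 3, 4 and 5 (2.8) -/

/-- **Pintz 1976 (IV), Theorem 3 — PROVED**: for `0 < ε < 0.05`, among moduli `D > D₀`, at most one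
real primitive character `χ_D` has `L(s, χ_D) = 0` somewhere in
`[1 − min(ε, 1/(140·32 log⁵D·D^{12ε})), 1]` (two such characters are the same: equal moduli, equal
values). From Theorem 2 (`pintz1976Heilbronn_theorem2_holds`) by the printed deduction (4.2)
(`Pintz1976Heilbronn.theorem3_of_theorem2`). Discharges the named fact `pintz1976Heilbronn_theorem3`.
[cite: Pintz1976ElementaryIV, Theorem 3 p. 423 (2.5); proof §4 p. 427 (4.2)] -/
theorem pintz1976Heilbronn_theorem3_holds : pintz1976Heilbronn_theorem3 :=
  Pintz1976Heilbronn.theorem3_of_theorem2 pintz1976Heilbronn_theorem2_holds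

/-- **Pintz 1976 (IV), Theorem 4 — PROVED** (Tatuzawa's theorem re-derived): for every `ε > 0` there
is `D₀(ε)` such that of two distinct real primitive characters of moduli `> D₀(ε)` at least one,
`χ_D`, has `L(s, χ_D) ≠ 0` on `[1 − D^{−ε}, 1]` and `L(1, χ_D) > D^{−ε}`. From Theorem 3 and the tree's
proved Hecke theorem (`Pintz1976Heilbronn.theorem4_of_theorem3`). Discharges the named fact
`pintz1976Heilbronn_theorem4`. [cite: Pintz1976ElementaryIV, Theorem 4 p. 423 (2.6)–(2.7); proof §4 p. 427 (4.3)] -/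
theorem pintz1976Heilbronn_theorem4_holds : pintz1976Heilbronn_theorem4 :=
  Pintz1976Heilbronn.theorem4_of_theorem3 pintz1976Heilbronn_theorem3_holds

/-- **Pintz 1976 (IV), Theorem 5 (2.8) — PROVED**: for every `ε > 0` there is `D₁(ε)` such that of
two imaginary quadratic fields with different discriminants `−D ≤ −D₁(ε)` at least one has
`h(−D) > D^{1/2−ε}`. From Theorem 4 with `ε/2` and Dirichlet's class number formula
(`Pintz1976Heilbronn.theorem5a_of_theorem4`). Discharges the named fact `pintz1976Heilbronn_theorem5a`.
[cite: Pintz1976ElementaryIV, Theorem 5 p. 424 (2.8); proof §4 p. 427] -/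
theorem pintz1976Heilbronn_theorem5a_holds : pintz1976Heilbronn_theorem5a :=
  Pintz1976Heilbronn.theorem5a_of_theorem4 pintz1976Heilbronn_theorem4_holds

end Literature.NumberTheory.LFunctions

end
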